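import Summits.QuantumFields.BalabanUV.Beta.HessKerCoDressedBmWall
import Summits.QuantumFields.BalabanUV.Beta.RowD1JointEnd
import Summits.QuantumFields.BalabanUV.Beta.FP.RoadRebasedHoldsBm

/-!
# `BalabanUV.Beta.HessKerCoDressedBmWallRec` — the road-A2 ∕ asym1 wall END over the RECURSIVE block-mean family `SpineRooted.JsRecBmAtOf`
# and over THE LITERAL OF RECORD `RowD1JointEnd.JsRowD1` (= `JsRecWAtOf` = `JsRecBmAtOf … (W := WrecAt …)`), SOCKETED ON THE BLOCK-MEAN
# CO-DRESSED RESOLVENTS — the decl-by-decl twin of asym1's `HessKerCoDressedBmWall` §3∕§5∕§6 with `JsBalBmAtOf ↦ JsRecBmAtOf`,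
# `Sfl j ↦ SrecAt 3 Lc (toSite r) cE cVH cΛ j` (G-an2-4 formalisation swarm PART V «SREC», row V7 = SKELETON-SREC ask (A-1))

AUTHORSHIP ∕ CONSENT.  Template = asym1 gen 21's `HessKerCoDressedBmWall` (every statement below is its statement with the two substitutions;
nothing of that file is edited).  Filed by the G-an2-4 swarm leaf seat `b2b-balaban-gan24-formalise-leaf-02` (gen 33) on the owner gan24-p1's row
V7 («free for an idle seat with asym1's consent»); consent line: see the journal (ASK (A-1) 2026-08-20T17:22Z and its answer).

HONEST FRAMING (cell contract, verbatim): «discharging `BetaPertH` makes Bałaban's UV stability UNCONDITIONAL — a real constructive-QFT result; it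
is NOT the continuum limit and NOT the Clay problem.»  HONEST DEPENDENCY (verbatim): «continuum YM on T⁴ ⇐ BetaPertH ∧ nine spine estimates (0/9 proved);
BetaPertH ⇐ (D1) ∧ (D4) ∧ CAP+tail; G-an2-4 gates asym, D1 and NE2/3/4.»  THIS MODULE is a CONSUMER SOCKET: it proves, for the recursive family, that the
wall `D1Drift` is EQUIVALENT to the explicit identification of the limit second moment with `stepBal N Lc` UNDER rows that are HYPOTHESES (S-slot rows on
`unitS_j (SrecAt … j)` = PART V's target «SrecShape» ∧ «SrecRate»; W-slot rows on `unitW_j (W j)`; K-rows — the latter DISCHARGED in §4 by gan24's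
`KSlotAssembly.convCKWall_holds` through this lineage's `FP/RoadRebasedHoldsBm.exists_bm_rows_of_slots`).  It mints no `Prop`, cites nothing, instantiates
no binder at a value, and DISCHARGES NOTHING of (hS, hSall) ∕ (hW, hWall); the identification itself (O-asym1-7) is NOT claimed.  0 `def`, 0 sorry.
NEVER «G-an2-4 closed»; NOT D1, NOT BetaPertH, NOT continuum, NOT Clay.

ABSOLUTE RULE (cell, verbatim): «No internally-minted statement may enter as a cited fact. Every hypothesis is either kernel-proved in this package or a
verbatim quotation of a PUBLISHED theorem with page reference. The manuscript(s) under audit are NOT citable for their own disputed steps — they are the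
thing under adjudication; programme-internal (2001/route/tribunal) claims are never citable.»

CONTENT (`d = 3`; [folklore] compositions BY NAME).
* §1 `TbalOf_JsRecBmAtOf_codressedBm(_unit)` — an2's `TbalOf_dressBmAt` on `JsRecBmAtOf = dressBmAt hr ∘ JsRec0AtOf` (`rfl`), `JsRec0AtOf_S` ∕ `_W`:
  `TbalOf Lc (JsRecBmAtOf …) j = hessKer G_j (vertexOfK G_j Lc (SrecAt 3 Lc (toSite r) cE cVH cΛ j)) (W j)`, `G_j = coDressKBmAt (toSite r) Lc (KInvStep Lc j)`;
  four-family unit form by `HessKerFourFamily.hessKer_four_unit`.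
* §2 **`d1Drift_JsRecBmAtOf_iff_of_lim_codressedBm_unit`** ∕ **`d1Drift_JsRecBmAtOf_iff_of_cauchy_codressedBm_unit`** — asym1's §3 with the substitutions
  (any in-block root, any tables `W` with `VertexFamily₂` data, any nonzero units, `Lc ≥ 1`).
* §3 **`d1Drift_JsRecBmAtOf_iff_codressedBm_of_unit_rows`** — asym1's §5 pattern: the ENTRYWISE K-rows of `D_j K_j D_j` (window `R < δK∕4`) already give it
  (`exists_coDressedBm_unit_rows`).
* §4 **`d1Drift_JsRecBmAtOf_iff_of_slots`** — ADOPTED UNITS `(sfStep Lc j, smStep 3 Lc j)`, `2 ≤ Lc`, K-SIDE DISCHARGED: given ONLY `j`-uniform S-rows + all-scales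
  S-deviations (rate `θS`) on `unitS_j (SrecAt … j)`, the same for `unitW_j (W j)` (rate `θW`), `0 < δS`, `0 < δW`: the wall `↔` the identification at the
  constructed limits (`exists_bm_rows_of_slots`: gan24-p1's `convCKWall_holds` → asym1's `HessKerConvCKPlug.exists_merged_rows` → `exists_coDressedBm_unit_rows`).
* §5 THE LITERAL OF RECORD (odd `Lc`, root `ctrOff 4 Lc`, pins `(Lc⁴, −Lc⁸∕2)`, `W := WrecAt …` at `cE₂ = Lc⁸`, `T_W = (8N²)⁻¹ • wsym22 N`, an1's `vh₂SAn1 Lc`, `mixFFAt ρ_c Lc`):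
  **`d1Drift_JsRowD1_iff_of_cauchy_codressedBm_unit`** and **`d1Drift_JsRowD1_iff_of_slots`** (`JsRowD1 = JsRecBmAtOf …` by `rfl`).
STATUS OF THE SOCKET (row owner gan24-p1-g13's DESIGN CORRECTION 2026-08-20T17:25Z + `S-REC-SIZING.md` v2: «V6∕V7 unchanged in shape but now
conditional on the redesign»): the displayed `(hS, hSall)` on `unitS_j (SrecAt … j)` ARE PART V's targets «SrecShape» ∧ «SrecRate» and may turn out
UNFEEDABLE for the literal (E) as recursed today; §1–§4 (generic root ∕ pins ∕ tables) survive any re-pinning, §5 is re-pointed if X-an2-51's follow-up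
changes the literal, and a change of the S-recursion itself needs the same rename-level twin over the new family (same template).
Provenance: unit `b2b-balaban-gan24-formalise-leaf-02` (gen 33), 2026-08-20; template asym1 gen 21; no existing file touched.
-/

open Finset Filter Topology
open scoped BigOperators
open Literature.MathematicalPhysics.QuantumFieldTheory.Balaban1983to89
open Literature.MathematicalPhysics.QuantumFieldTheory.Balaban1983to89.Beta
open ExpKernelCalculus (MKer Decays VertexFamily₂ hessKer)
open AffineAveraging (box toSite)
open AveragingContoursRooted (ctrOff ctrOff_mem_box)
open AveragingMixedJetTables (mixFFAt)
open OneStepResolventKernel (Fib LocStencil JetData)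
open OneStepKernelFamily (vertexOfK KInvStep TbalOf D1Drift)
open WilsonVertex2Sym (wsym22)
open HessKerDressedLimit (limMKerOf limStOf limTabOf decays_limMKerOf decays_sub_limMKerOf locStencil_limStOf locStencil_sub_limStOf
  vertexFamily₂_limTabOf vertexFamily₂_sub_limTabOf)
open Summit.QuantumFields.BalabanUV.Beta.HessKerDressedUnits (unitK unitS unitW)
open Summit.QuantumFields.BalabanUV.Beta.HessKerFourFamily (hessKer_four_unit d1Drift_iff_of_lim_four)
open Summit.QuantumFields.BalabanUV.Beta.AxialDressingRooted (coDressKBmAt dressBmAt TbalOf_dressBmAt)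
open Summit.QuantumFields.BalabanUV.Beta.WardLocusRecursive (SrecAt)
open Summit.QuantumFields.BalabanUV.Beta.SpineRooted (JsRec0AtOf JsRec0AtOf_S JsRec0AtOf_W JsRecBmAtOf JsRecWAtOf WrecAt CwRecOf δwRecOf
  δwRecOf_pos WrecAt_loc₂)
open Summit.QuantumFields.BalabanUV.Beta.SecondOrderSocketIdentification (vh₂SAn1)
open Summit.QuantumFields.BalabanUV.Beta.SecondOrderTableLawEnd (locStencil₂_vh₂SAn1)
open Summit.QuantumFields.BalabanUV.Beta.MixedJetTablesPlug (hmix_an1)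
open Summit.QuantumFields.BalabanUV.Beta.RowD1JointEnd (JsRowD1)
open Summit.QuantumFields.BalabanUV.Beta.HessKerCoDressedBmWall (exists_coDressedBm_unit_rows)
open Summit.QuantumFields.BalabanUV.Beta.GAN24.CombesThomas (sfStep smStep sfStep_ne_zero smStep_ne_zero)
open Summit.QuantumFields.BalabanUV.Beta.FP.RoadRebasedHoldsBm (exists_bm_rows_of_slots)

namespace Summit.QuantumFields.BalabanUV.Beta.HessKerCoDressedBmWallRec

noncomputable section

/-! ## §1 The recursive block-mean family's kernels in co-dressed four-family form -/

section ClosedForm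

variable {Lc : ℕ} [NeZero Lc] (hLc : 1 ≤ Lc) {r : Fin (3 + 1) → ℕ} (hr : r ∈ box (3 + 1) Lc) (cE cVH cΛ : ℝ)
  (W : ℕ → Fin (3 + 1) → (Fin (3 + 1) → ℤ) → Fin (3 + 1) → (Fin (3 + 1) → ℤ) → MKer (3 + 1) (Fib 3))
  (Cw' δw : ℕ → ℝ) (hδw : ∀ j, 0 < δw j) (hW' : ∀ j, VertexFamily₂ (W j) Lc (Cw' j) (δw j)) (sf sm : ℕ → ℝ)

/-- [folklore] **an2's BLOCK-MEAN DRESSED-KERNEL IDENTITY FOR THE RECURSIVE FAMILY**: `TbalOf Lc (JsRecBmAtOf …) j =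
hessKer G_j (vertexOfK G_j Lc (SrecAt 3 Lc (toSite r) cE cVH cΛ j)) (W j)`, `G_j = coDressKBmAt (toSite r) Lc (KInvStep Lc j)`
(`TbalOf_dressBmAt` on `JsRecBmAtOf = dressBmAt hr ∘ JsRec0AtOf` (`rfl`), `JsRec0AtOf_S`, `JsRec0AtOf_W`). -/
theorem TbalOf_JsRecBmAtOf_codressedBm (j : ℕ) :
    TbalOf Lc (JsRecBmAtOf (d := 3) hLc hr cE cVH cΛ W Cw' δw hδw hW') j =
      hessKer (coDressKBmAt (toSite r) Lc (KInvStep (d := 3) Lc j))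
        (vertexOfK (coDressKBmAt (toSite r) Lc (KInvStep (d := 3) Lc j)) Lc (SrecAt 3 Lc (toSite r) cE cVH cΛ j)) (W j) := by
  have h := TbalOf_dressBmAt hr (JsRec0AtOf (d := 3) hLc hr cE cVH cΛ W Cw' δw hδw hW') j
  rw [JsRec0AtOf_S, JsRec0AtOf_W] at h
  exact h

/-- [folklore] **THE SAME IN ANY NONZERO LEG UNITS, AS A FOUR-FAMILY FORM ON `D_j G_j D_j`** (`HessKerFourFamily.hessKer_four_unit`). -/
theorem TbalOf_JsRecBmAtOf_codressedBm_unit (hsf : ∀ j, sf j ≠ 0) (hsm : ∀ j, sm j ≠ 0) (j : ℕ) :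
    TbalOf Lc (JsRecBmAtOf (d := 3) hLc hr cE cVH cΛ W Cw' δw hδw hW') j =
      hessKer (unitK (sf j) (sm j) (coDressKBmAt (toSite r) Lc (KInvStep (d := 3) Lc j)))
        (vertexOfK (unitK (sf j) (sm j) (coDressKBmAt (toSite r) Lc (KInvStep (d := 3) Lc j))) Lc
          (unitS (sf j) (sm j) (SrecAt 3 Lc (toSite r) cE cVH cΛ j)))
        (unitW (sf j) (sm j) (W j)) := by
  rw [TbalOf_JsRecBmAtOf_codressedBm hLc hr cE cVH cΛ W Cw' δw hδw hW' j]
  exact (hessKer_four_unit (hsf j) (hsm j) Lc _ _ (SrecAt 3 Lc (toSite r) cE cVH cΛ j) (W j)).symm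

end ClosedForm

/-! ## §2 The END: the recursive family's wall ⟺ the explicit identification, co-dressed K-slot, any units -/

section End

variable {Lc : ℕ} [NeZero Lc] (hLc : 1 ≤ Lc) {r : Fin (3 + 1) → ℕ} (hr : r ∈ box (3 + 1) Lc) (cE cVH cΛ : ℝ)
  (W : ℕ → Fin (3 + 1) → (Fin (3 + 1) → ℤ) → Fin (3 + 1) → (Fin (3 + 1) → ℤ) → MKer (3 + 1) (Fib 3))
  (Cw' δw : ℕ → ℝ) (hδw : ∀ j, 0 < δw j) (hW' : ∀ j, VertexFamily₂ (W j) Lc (Cw' j) (δw j)) (sf sm : ℕ → ℝ)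
  {Ginf : MKer (3 + 1) (Fib 3)} {Sinf : Fin (3 + 1) → (Fin (3 + 1) → ℤ) → MKer (3 + 1) (Fib 3)}
  {Winf : Fin (3 + 1) → (Fin (3 + 1) → ℤ) → Fin (3 + 1) → (Fin (3 + 1) → ℤ) → MKer (3 + 1) (Fib 3)}
  {R C cK δK Cs cS δS Cw cW δW θ : ℝ}

/-- [folklore] **THE RECURSIVE BLOCK-MEAN FAMILY'S WALL ⟺ THE EXPLICIT IDENTIFICATION, LIMIT CURRENCY, CO-DRESSED K-SLOT, ANY UNITS**: rows and
deviations with rate `θ` of `D_j G_j D_j`, of `unitS_j (SrecAt … j)`, of `unitW_j (W j)` against named limits `(G∞, S∞, W∞)`, `0 ≤ θ < 1` ⟹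
`D1Drift Lc (JsRecBmAtOf …) N μ ν ↔ secondMoment (hessKer G∞ (vertexOfK G∞ Lc S∞) W∞) μ ν = stepBal N Lc`.  Discharges NOTHING. -/
theorem d1Drift_JsRecBmAtOf_iff_of_lim_codressedBm_unit (hsf : ∀ j, sf j ≠ 0) (hsm : ∀ j, sm j ≠ 0)
    (hG : ∀ j, Decays (unitK (sf j) (sm j) (coDressKBmAt (toSite r) Lc (KInvStep (d := 3) Lc j))) C δK) (hGinf : Decays Ginf C δK)
    (hGrate : ∀ j, Decays (unitK (sf j) (sm j) (coDressKBmAt (toSite r) Lc (KInvStep (d := 3) Lc j)) - Ginf) (cK * θ ^ j) δK)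
    (hS : ∀ j, LocStencil (unitS (sf j) (sm j) (SrecAt 3 Lc (toSite r) cE cVH cΛ j)) Cs δS) (hSinf : LocStencil Sinf Cs δS)
    (hSrate : ∀ j, LocStencil (unitS (sf j) (sm j) (SrecAt 3 Lc (toSite r) cE cVH cΛ j) - Sinf) (cS * θ ^ j) δS)
    (hW : ∀ j, VertexFamily₂ (unitW (sf j) (sm j) (W j)) Lc Cw δW) (hWinf : VertexFamily₂ Winf Lc Cw δW)
    (hWrate : ∀ j, VertexFamily₂ (unitW (sf j) (sm j) (W j) - Winf) Lc (cW * θ ^ j) δW)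
    (hR : 0 < R) (hRK : R < δK) (hRS : R / 2 < δS) (hRW : R < δW) (hθ0 : 0 ≤ θ) (hθ1 : θ < 1) (μ ν : Fin 4) (N : ℝ) :
    D1Drift Lc (JsRecBmAtOf (d := 3) hLc hr cE cVH cΛ W Cw' δw hδw hW') N μ ν ↔
      B12Beta.secondMoment (hessKer Ginf (vertexOfK Ginf Lc Sinf) Winf) μ ν = B12Normalization.stepBal N Lc :=
  d1Drift_iff_of_lim_four (JsRecBmAtOf (d := 3) hLc hr cE cVH cΛ W Cw' δw hδw hW')
    (A := fun j => unitK (sf j) (sm j) (coDressKBmAt (toSite r) Lc (KInvStep (d := 3) Lc j)))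
    (K := fun j => unitK (sf j) (sm j) (coDressKBmAt (toSite r) Lc (KInvStep (d := 3) Lc j)))
    (S := fun j => unitS (sf j) (sm j) (SrecAt 3 Lc (toSite r) cE cVH cΛ j)) (W := fun j => unitW (sf j) (sm j) (W j)) (Ainf := Ginf)
    (Kinf := Ginf) (Sinf := Sinf) (Winf := Winf)
    (TbalOf_JsRecBmAtOf_codressedBm_unit hLc hr cE cVH cΛ W Cw' δw hδw hW' sf sm hsf hsm) hG hGinf hGrate hG hGinf hGrate hS hSinf hSrate hW
    hWinf hWrate hR hRK hRS hRW hθ0 hθ1 μ ν N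

/-- [folklore] **THE RECURSIVE BLOCK-MEAN FAMILY'S WALL ⟺ THE EXPLICIT IDENTIFICATION AT THE CONSTRUCTED LIMITS, CAUCHY CURRENCY, CO-DRESSED K-SLOT,
ANY UNITS**: `j`-uniform rows + ALL-SCALES deviations with rate `θ` of `D_j G_j D_j`, of `unitS_j (SrecAt … j)`, of `unitW_j (W j)`, `0 ≤ θ < 1` ⟹
the wall `↔` the identification at `G∞ = limMKerOf (D G D)`, `S∞ = limStOf (unitS (SrecAt …))`, `W∞ = limTabOf (unitW W)`.  Discharges NOTHING. -/
theorem d1Drift_JsRecBmAtOf_iff_of_cauchy_codressedBm_unit (hsf : ∀ j, sf j ≠ 0) (hsm : ∀ j, sm j ≠ 0)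
    (hG : ∀ j, Decays (unitK (sf j) (sm j) (coDressKBmAt (toSite r) Lc (KInvStep (d := 3) Lc j))) C δK)
    (hGall : ∀ k j, Decays (unitK (sf (k + j)) (sm (k + j)) (coDressKBmAt (toSite r) Lc (KInvStep (d := 3) Lc (k + j))) -
      unitK (sf k) (sm k) (coDressKBmAt (toSite r) Lc (KInvStep (d := 3) Lc k))) (cK * θ ^ k) δK)
    (hS : ∀ j, LocStencil (unitS (sf j) (sm j) (SrecAt 3 Lc (toSite r) cE cVH cΛ j)) Cs δS)
    (hSall : ∀ k j, LocStencil (unitS (sf (k + j)) (sm (k + j)) (SrecAt 3 Lc (toSite r) cE cVH cΛ (k + j)) -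
      unitS (sf k) (sm k) (SrecAt 3 Lc (toSite r) cE cVH cΛ k)) (cS * θ ^ k) δS)
    (hW : ∀ j, VertexFamily₂ (unitW (sf j) (sm j) (W j)) Lc Cw δW)
    (hWall : ∀ k j, VertexFamily₂ (unitW (sf (k + j)) (sm (k + j)) (W (k + j)) - unitW (sf k) (sm k) (W k)) Lc (cW * θ ^ k) δW)
    (hR : 0 < R) (hRK : R < δK) (hRS : R / 2 < δS) (hRW : R < δW) (hθ0 : 0 ≤ θ) (hθ1 : θ < 1) (μ ν : Fin 4) (N : ℝ) :
    D1Drift Lc (JsRecBmAtOf (d := 3) hLc hr cE cVH cΛ W Cw' δw hδw hW') N μ ν ↔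
      B12Beta.secondMoment (hessKer (limMKerOf fun j => unitK (sf j) (sm j) (coDressKBmAt (toSite r) Lc (KInvStep (d := 3) Lc j)))
        (vertexOfK (limMKerOf fun j => unitK (sf j) (sm j) (coDressKBmAt (toSite r) Lc (KInvStep (d := 3) Lc j))) Lc
          (limStOf fun j => unitS (sf j) (sm j) (SrecAt 3 Lc (toSite r) cE cVH cΛ j)))
        (limTabOf fun j => unitW (sf j) (sm j) (W j))) μ ν = B12Normalization.stepBal N Lc :=
  d1Drift_JsRecBmAtOf_iff_of_lim_codressedBm_unit hLc hr cE cVH cΛ W Cw' δw hδw hW' sf sm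
    (Ginf := limMKerOf fun j => unitK (sf j) (sm j) (coDressKBmAt (toSite r) Lc (KInvStep (d := 3) Lc j)))
    (Sinf := limStOf fun j => unitS (sf j) (sm j) (SrecAt 3 Lc (toSite r) cE cVH cΛ j)) (Winf := limTabOf fun j => unitW (sf j) (sm j) (W j))
    hsf hsm hG (decays_limMKerOf hG hGall hθ1) (decays_sub_limMKerOf hGall hθ1) hS (locStencil_limStOf hS hSall hθ1)
    (locStencil_sub_limStOf hSall hθ1) hW (vertexFamily₂_limTabOf hW hWall hθ1) (vertexFamily₂_sub_limTabOf hWall hθ1) hR hRK hRS hRW hθ0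
    hθ1 μ ν N

/-! ## §3 Consistency with the ENTRYWISE K-rows (the currency of `GAN24.CombesThomas.ConvCKWall 3 Lc`) -/

/-- [folklore] **THE ENTRYWISE K-ROWS ALREADY GIVE THE RECURSIVE FAMILY's CO-DRESSED IDENTIFICATION** (window `R < δK∕4`): rows of the RESCALED
decimated resolvents `D_j K_j D_j` themselves give the co-dressed K-rows at `(c·C, δK∕4, c·c_K, θ)` (`exists_coDressedBm_unit_rows`). -/
theorem d1Drift_JsRecBmAtOf_iff_codressedBm_of_unit_rows (hsf : ∀ j, sf j ≠ 0) (hsm : ∀ j, sm j ≠ 0)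
    (hK : ∀ j, Decays (unitK (sf j) (sm j) (KInvStep (d := 3) Lc j)) C δK)
    (hKall : ∀ k j, Decays (unitK (sf (k + j)) (sm (k + j)) (KInvStep (d := 3) Lc (k + j)) -
      unitK (sf k) (sm k) (KInvStep (d := 3) Lc k)) (cK * θ ^ k) δK)
    (hS : ∀ j, LocStencil (unitS (sf j) (sm j) (SrecAt 3 Lc (toSite r) cE cVH cΛ j)) Cs δS)
    (hSall : ∀ k j, LocStencil (unitS (sf (k + j)) (sm (k + j)) (SrecAt 3 Lc (toSite r) cE cVH cΛ (k + j)) -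
      unitS (sf k) (sm k) (SrecAt 3 Lc (toSite r) cE cVH cΛ k)) (cS * θ ^ k) δS)
    (hW : ∀ j, VertexFamily₂ (unitW (sf j) (sm j) (W j)) Lc Cw δW)
    (hWall : ∀ k j, VertexFamily₂ (unitW (sf (k + j)) (sm (k + j)) (W (k + j)) - unitW (sf k) (sm k) (W k)) Lc (cW * θ ^ k) δW)
    (hR : 0 < R) (hRK : R < δK / 4) (hRS : R / 2 < δS) (hRW : R < δW) (hθ0 : 0 ≤ θ) (hθ1 : θ < 1) (μ ν : Fin 4) (N : ℝ) :
    D1Drift Lc (JsRecBmAtOf (d := 3) hLc hr cE cVH cΛ W Cw' δw hδw hW') N μ ν ↔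
      B12Beta.secondMoment (hessKer (limMKerOf fun j => unitK (sf j) (sm j) (coDressKBmAt (toSite r) Lc (KInvStep (d := 3) Lc j)))
        (vertexOfK (limMKerOf fun j => unitK (sf j) (sm j) (coDressKBmAt (toSite r) Lc (KInvStep (d := 3) Lc j))) Lc
          (limStOf fun j => unitS (sf j) (sm j) (SrecAt 3 Lc (toSite r) cE cVH cΛ j)))
        (limTabOf fun j => unitW (sf j) (sm j) (W j))) μ ν = B12Normalization.stepBal N Lc := by
  have hδK : 0 < δK := by linarith
  obtain ⟨c, -, hG, hGall⟩ :=
    exists_coDressedBm_unit_rows hLc hr sf sm hsf hsm (K := fun j => KInvStep (d := 3) Lc j) hδK hK hKall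
  exact d1Drift_JsRecBmAtOf_iff_of_cauchy_codressedBm_unit hLc hr cE cVH cΛ W Cw' δw hδw hW' sf sm hsf hsm hG hGall hS hSall hW hWall hR
    hRK hRS hRW hθ0 hθ1 μ ν N

end End

/-! ## §4 Adopted units, K-side DISCHARGED by row G-an2-4's K-slot: the wall ⟺ the identification under the S- and W-slot rows alone -/

section Slots

variable {Lc : ℕ} [NeZero Lc] {r : Fin (3 + 1) → ℕ} (cE cVH cΛ : ℝ)
  (W : ℕ → Fin (3 + 1) → (Fin (3 + 1) → ℤ) → Fin (3 + 1) → (Fin (3 + 1) → ℤ) → MKer (3 + 1) (Fib 3))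
  (Cw' δw : ℕ → ℝ) (hδw : ∀ j, 0 < δw j) (hW' : ∀ j, VertexFamily₂ (W j) Lc (Cw' j) (δw j))
  {Cs cS θS δS Cw cW θW δW : ℝ}

/-- **THE RECURSIVE BLOCK-MEAN FAMILY'S WALL ⟺ THE IDENTIFICATION, K-SIDE DISCHARGED** (`d = 3`, `2 ≤ Lc`, adopted units `(sfStep Lc j, smStep 3 Lc j)`,
any in-block root, any tables `W`): given ONLY the S-slot rows («SrecShape»: `j`-uniform localisation of `unitS_j (SrecAt … j)`; «SrecRate»: all-scales
deviations at some rate `θS ∈ [0,1)`) and the W-slot rows on `unitW_j (W j)` (rate `θW`), `0 < δS`, `0 < δW`: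
`D1Drift Lc (JsRecBmAtOf …) N μ ν ↔ secondMoment (hessKer G∞ (vertexOfK G∞ Lc S∞) W∞) μ ν = stepBal N Lc` at the constructed limits.  The K-rows come from
gan24-p1's `KSlotAssembly.convCKWall_holds` (row G-an2-4's K-slot, UNCONDITIONAL for `Lc ≥ 2`) through asym1's merge ∕ co-dressing lemmas
(`FP/RoadRebasedHoldsBm.exists_bm_rows_of_slots` BY NAME).  Discharges NOTHING of the S-∕W-rows. [our object] -/
theorem d1Drift_JsRecBmAtOf_iff_of_slots (hLc2 : 2 ≤ Lc) (hr : r ∈ box (3 + 1) Lc)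
    (hS : ∀ j, LocStencil (unitS (sfStep Lc j) (smStep 3 Lc j) (SrecAt 3 Lc (toSite r) cE cVH cΛ j)) Cs δS)
    (hSall : ∀ k j, LocStencil (unitS (sfStep Lc (k + j)) (smStep 3 Lc (k + j)) (SrecAt 3 Lc (toSite r) cE cVH cΛ (k + j)) -
      unitS (sfStep Lc k) (smStep 3 Lc k) (SrecAt 3 Lc (toSite r) cE cVH cΛ k)) (cS * θS ^ k) δS)
    (hW : ∀ j, VertexFamily₂ (unitW (sfStep Lc j) (smStep 3 Lc j) (W j)) Lc Cw δW)
    (hWall : ∀ k j, VertexFamily₂ (unitW (sfStep Lc (k + j)) (smStep 3 Lc (k + j)) (W (k + j)) -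
      unitW (sfStep Lc k) (smStep 3 Lc k) (W k)) Lc (cW * θW ^ k) δW)
    (hδS : 0 < δS) (hδW : 0 < δW) (hθS0 : 0 ≤ θS) (hθS1 : θS < 1) (hθW0 : 0 ≤ θW) (hθW1 : θW < 1) (μ ν : Fin 4) (N : ℝ) :
    D1Drift Lc (JsRecBmAtOf (d := 3) (by omega : 1 ≤ Lc) hr cE cVH cΛ W Cw' δw hδw hW') N μ ν ↔
      B12Beta.secondMoment (hessKer
          (limMKerOf fun j => unitK (sfStep Lc j) (smStep 3 Lc j) (coDressKBmAt (toSite r) Lc (KInvStep (d := 3) Lc j)))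
        (vertexOfK (limMKerOf fun j => unitK (sfStep Lc j) (smStep 3 Lc j) (coDressKBmAt (toSite r) Lc (KInvStep (d := 3) Lc j))) Lc
          (limStOf fun j => unitS (sfStep Lc j) (smStep 3 Lc j) (SrecAt 3 Lc (toSite r) cE cVH cΛ j)))
        (limTabOf fun j => unitW (sfStep Lc j) (smStep 3 Lc j) (W j))) μ ν = B12Normalization.stepBal N Lc := by
  obtain ⟨C, δK, cK, θ, R, hR, hRK, hRS, hRW, hθ0, hθ1, hG, hGall, hSall', hWall'⟩ :=
    exists_bm_rows_of_slots (Lc := Lc) hLc2 hr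
      (S := fun j => unitS (sfStep Lc j) (smStep 3 Lc j) (SrecAt 3 Lc (toSite r) cE cVH cΛ j))
      (W := fun j => unitW (sfStep Lc j) (smStep 3 Lc j) (W j)) hSall hWall hδS hδW hθS0 hθS1 hθW0 hθW1
  exact d1Drift_JsRecBmAtOf_iff_of_cauchy_codressedBm_unit (by omega) hr cE cVH cΛ W Cw' δw hδw hW' (sfStep Lc) (smStep 3 Lc)
    sfStep_ne_zero smStep_ne_zero hG hGall hS hSall' hW hWall' hR hRK hRS hRW hθ0 hθ1 μ ν N

end Slots

/-! ## §5 The literal of record `RowD1JointEnd.JsRowD1` (odd `Lc`, centred root, `W := WrecAt …`) -/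

section Record

variable {Lc : ℕ} [NeZero Lc] (hLc : Odd Lc) (N : ℕ) (cΛ cB : ℝ) (sf sm : ℕ → ℝ) {R C cK δK Cs cS δS Cw cW δW θ θS θW : ℝ}

/-- [folklore] **THE LITERAL OF RECORD IS THE RECURSIVE BLOCK-MEAN FAMILY AT ITS PINS AND an1's TABLES** — `JsRowD1 hLc N cΛ cB =
JsRecBmAtOf hLc.pos (ctrOff_mem_box hLc.pos) (Lc⁴) (−Lc⁸∕2) cΛ (WrecAt …) (CwRecOf …) (δwRecOf …) (δwRecOf_pos …) (WrecAt_loc₂ …)` (`rfl`: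
`JsRowD1 := JsRecWAtOf …`, `JsRecWAtOf := JsRecBmAtOf … (W := WrecAt …)`). -/
theorem JsRowD1_eq_JsRecBmAtOf :
    JsRowD1 hLc N cΛ cB =
      JsRecBmAtOf (d := 3) hLc.pos (ctrOff_mem_box hLc.pos) ((Lc : ℝ) ^ 4) (-((Lc : ℝ) ^ 8 / 2)) cΛ
        (WrecAt 3 Lc (toSite (ctrOff (3 + 1) Lc)) ((Lc : ℝ) ^ 4) (-((Lc : ℝ) ^ 8 / 2)) cΛ ((Lc : ℝ) ^ 8) cB ((8 * (N : ℝ) ^ 2)⁻¹ • wsym22 N)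
          (vh₂SAn1 Lc) (mixFFAt (toSite (ctrOff (3 + 1) Lc)) Lc))
        (CwRecOf hLc.pos (ctrOff_mem_box hLc.pos) ((Lc : ℝ) ^ 4) (-((Lc : ℝ) ^ 8 / 2)) cΛ ((Lc : ℝ) ^ 8) cB ((8 * (N : ℝ) ^ 2)⁻¹ • wsym22 N)
          (locStencil₂_vh₂SAn1 hLc) (hmix_an1 (d := 3) hLc.pos (ctrOff_mem_box hLc.pos)))
        (δwRecOf hLc.pos (ctrOff_mem_box hLc.pos) ((Lc : ℝ) ^ 4) (-((Lc : ℝ) ^ 8 / 2)) cΛ ((Lc : ℝ) ^ 8) cB ((8 * (N : ℝ) ^ 2)⁻¹ • wsym22 N)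
          (locStencil₂_vh₂SAn1 hLc) (hmix_an1 (d := 3) hLc.pos (ctrOff_mem_box hLc.pos)))
        (δwRecOf_pos hLc.pos (ctrOff_mem_box hLc.pos) ((Lc : ℝ) ^ 4) (-((Lc : ℝ) ^ 8 / 2)) cΛ ((Lc : ℝ) ^ 8) cB ((8 * (N : ℝ) ^ 2)⁻¹ • wsym22 N)
          (locStencil₂_vh₂SAn1 hLc) (hmix_an1 (d := 3) hLc.pos (ctrOff_mem_box hLc.pos)))
        (WrecAt_loc₂ hLc.pos (ctrOff_mem_box hLc.pos) ((Lc : ℝ) ^ 4) (-((Lc : ℝ) ^ 8 / 2)) cΛ ((Lc : ℝ) ^ 8) cB ((8 * (N : ℝ) ^ 2)⁻¹ • wsym22 N)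
          (locStencil₂_vh₂SAn1 hLc) (hmix_an1 (d := 3) hLc.pos (ctrOff_mem_box hLc.pos))) := rfl

/-- **THE WALL AT THE LITERAL OF RECORD ⟺ THE EXPLICIT IDENTIFICATION AT THE CONSTRUCTED LIMITS, CAUCHY CURRENCY, CO-DRESSED K-SLOT, ANY UNITS**
(odd `Lc`; §2 at the record's root `ctrOff 4 Lc`, pins `(Lc⁴, −Lc⁸∕2)` and tables `WrecAt …`): rows + all-scales deviations (rate `θ`) of
`D_j G_j D_j` (`G_j = coDressKBmAt ρ_c Lc (KInvStep Lc j)`), of `unitS_j (SrecAt 3 Lc ρ_c Lc⁴ (−Lc⁸∕2) cΛ j)`, of `unitW_j (WrecAt … j)` ⟹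
`D1Drift Lc (JsRowD1 hLc N cΛ cB) Nc μ ν ↔ secondMoment (hessKer G∞ (vertexOfK G∞ Lc S∞) W∞) μ ν = stepBal Nc Lc`.  Discharges NOTHING. [our object] -/
theorem d1Drift_JsRowD1_iff_of_cauchy_codressedBm_unit (hsf : ∀ j, sf j ≠ 0) (hsm : ∀ j, sm j ≠ 0)
    (hG : ∀ j, Decays (unitK (sf j) (sm j) (coDressKBmAt (toSite (ctrOff (3 + 1) Lc)) Lc (KInvStep (d := 3) Lc j))) C δK)
    (hGall : ∀ k j, Decays (unitK (sf (k + j)) (sm (k + j)) (coDressKBmAt (toSite (ctrOff (3 + 1) Lc)) Lc (KInvStep (d := 3) Lc (k + j))) -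
      unitK (sf k) (sm k) (coDressKBmAt (toSite (ctrOff (3 + 1) Lc)) Lc (KInvStep (d := 3) Lc k))) (cK * θ ^ k) δK)
    (hS : ∀ j, LocStencil (unitS (sf j) (sm j) (SrecAt 3 Lc (toSite (ctrOff (3 + 1) Lc)) ((Lc : ℝ) ^ 4) (-((Lc : ℝ) ^ 8 / 2)) cΛ j)) Cs δS)
    (hSall : ∀ k j, LocStencil (unitS (sf (k + j)) (sm (k + j)) (SrecAt 3 Lc (toSite (ctrOff (3 + 1) Lc)) ((Lc : ℝ) ^ 4) (-((Lc : ℝ) ^ 8 / 2)) cΛ (k + j)) -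
      unitS (sf k) (sm k) (SrecAt 3 Lc (toSite (ctrOff (3 + 1) Lc)) ((Lc : ℝ) ^ 4) (-((Lc : ℝ) ^ 8 / 2)) cΛ k)) (cS * θ ^ k) δS)
    (hW : ∀ j, VertexFamily₂ (unitW (sf j) (sm j)
      (WrecAt 3 Lc (toSite (ctrOff (3 + 1) Lc)) ((Lc : ℝ) ^ 4) (-((Lc : ℝ) ^ 8 / 2)) cΛ ((Lc : ℝ) ^ 8) cB ((8 * (N : ℝ) ^ 2)⁻¹ • wsym22 N)
        (vh₂SAn1 Lc) (mixFFAt (toSite (ctrOff (3 + 1) Lc)) Lc) j)) Lc Cw δW)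
    (hWall : ∀ k j, VertexFamily₂ (unitW (sf (k + j)) (sm (k + j))
      (WrecAt 3 Lc (toSite (ctrOff (3 + 1) Lc)) ((Lc : ℝ) ^ 4) (-((Lc : ℝ) ^ 8 / 2)) cΛ ((Lc : ℝ) ^ 8) cB ((8 * (N : ℝ) ^ 2)⁻¹ • wsym22 N)
        (vh₂SAn1 Lc) (mixFFAt (toSite (ctrOff (3 + 1) Lc)) Lc) (k + j)) -
      unitW (sf k) (sm k)
      (WrecAt 3 Lc (toSite (ctrOff (3 + 1) Lc)) ((Lc : ℝ) ^ 4) (-((Lc : ℝ) ^ 8 / 2)) cΛ ((Lc : ℝ) ^ 8) cB ((8 * (N : ℝ) ^ 2)⁻¹ • wsym22 N)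
        (vh₂SAn1 Lc) (mixFFAt (toSite (ctrOff (3 + 1) Lc)) Lc) k)) Lc (cW * θ ^ k) δW)
    (hR : 0 < R) (hRK : R < δK) (hRS : R / 2 < δS) (hRW : R < δW) (hθ0 : 0 ≤ θ) (hθ1 : θ < 1) (μ ν : Fin 4) (Nc : ℝ) :
    D1Drift Lc (JsRowD1 hLc N cΛ cB) Nc μ ν ↔
      B12Beta.secondMoment (hessKer
          (limMKerOf fun j => unitK (sf j) (sm j) (coDressKBmAt (toSite (ctrOff (3 + 1) Lc)) Lc (KInvStep (d := 3) Lc j)))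
        (vertexOfK (limMKerOf fun j => unitK (sf j) (sm j) (coDressKBmAt (toSite (ctrOff (3 + 1) Lc)) Lc (KInvStep (d := 3) Lc j))) Lc
          (limStOf fun j => unitS (sf j) (sm j) (SrecAt 3 Lc (toSite (ctrOff (3 + 1) Lc)) ((Lc : ℝ) ^ 4) (-((Lc : ℝ) ^ 8 / 2)) cΛ j)))
        (limTabOf fun j => unitW (sf j) (sm j)
          (WrecAt 3 Lc (toSite (ctrOff (3 + 1) Lc)) ((Lc : ℝ) ^ 4) (-((Lc : ℝ) ^ 8 / 2)) cΛ ((Lc : ℝ) ^ 8) cB ((8 * (N : ℝ) ^ 2)⁻¹ • wsym22 N)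
            (vh₂SAn1 Lc) (mixFFAt (toSite (ctrOff (3 + 1) Lc)) Lc) j))) μ ν = B12Normalization.stepBal Nc Lc := by
  rw [JsRowD1_eq_JsRecBmAtOf]
  exact d1Drift_JsRecBmAtOf_iff_of_cauchy_codressedBm_unit hLc.pos (ctrOff_mem_box hLc.pos) _ _ _ _ _ _ _ _ sf sm hsf hsm hG hGall hS
    hSall hW hWall hR hRK hRS hRW hθ0 hθ1 μ ν Nc

/-- **THE WALL AT THE LITERAL OF RECORD ⟺ THE IDENTIFICATION, K-SIDE DISCHARGED** (odd `Lc`, `2 ≤ Lc`, adopted units; §4 at the record): given ONLY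
the S-slot rows on `unitS_j (SrecAt 3 Lc ρ_c Lc⁴ (−Lc⁸∕2) cΛ j)` (PART V «SREC»'s «SrecShape» ∧ «SrecRate») and the W-slot rows on `unitW_j (WrecAt … j)`,
`0 < δS`, `0 < δW`, rates in `[0,1)`:
`D1Drift Lc (JsRowD1 hLc N cΛ cB) Nc μ ν ↔ secondMoment (hessKer G∞ (vertexOfK G∞ Lc S∞) W∞) μ ν = stepBal Nc Lc` at the constructed limits.
The socket the S-slot road (PART V) and the W-slot road feed for the literal of record.  Discharges NOTHING of those rows. [our object] -/
theorem d1Drift_JsRowD1_iff_of_slots (hLc2 : 2 ≤ Lc)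
    (hS : ∀ j, LocStencil (unitS (sfStep Lc j) (smStep 3 Lc j)
      (SrecAt 3 Lc (toSite (ctrOff (3 + 1) Lc)) ((Lc : ℝ) ^ 4) (-((Lc : ℝ) ^ 8 / 2)) cΛ j)) Cs δS)
    (hSall : ∀ k j, LocStencil (unitS (sfStep Lc (k + j)) (smStep 3 Lc (k + j))
      (SrecAt 3 Lc (toSite (ctrOff (3 + 1) Lc)) ((Lc : ℝ) ^ 4) (-((Lc : ℝ) ^ 8 / 2)) cΛ (k + j)) -
      unitS (sfStep Lc k) (smStep 3 Lc k) (SrecAt 3 Lc (toSite (ctrOff (3 + 1) Lc)) ((Lc : ℝ) ^ 4) (-((Lc : ℝ) ^ 8 / 2)) cΛ k)) (cS * θS ^ k) δS)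
    (hW : ∀ j, VertexFamily₂ (unitW (sfStep Lc j) (smStep 3 Lc j)
      (WrecAt 3 Lc (toSite (ctrOff (3 + 1) Lc)) ((Lc : ℝ) ^ 4) (-((Lc : ℝ) ^ 8 / 2)) cΛ ((Lc : ℝ) ^ 8) cB ((8 * (N : ℝ) ^ 2)⁻¹ • wsym22 N)
        (vh₂SAn1 Lc) (mixFFAt (toSite (ctrOff (3 + 1) Lc)) Lc) j)) Lc Cw δW)
    (hWall : ∀ k j, VertexFamily₂ (unitW (sfStep Lc (k + j)) (smStep 3 Lc (k + j))
      (WrecAt 3 Lc (toSite (ctrOff (3 + 1) Lc)) ((Lc : ℝ) ^ 4) (-((Lc : ℝ) ^ 8 / 2)) cΛ ((Lc : ℝ) ^ 8) cB ((8 * (N : ℝ) ^ 2)⁻¹ • wsym22 N)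
        (vh₂SAn1 Lc) (mixFFAt (toSite (ctrOff (3 + 1) Lc)) Lc) (k + j)) -
      unitW (sfStep Lc k) (smStep 3 Lc k)
      (WrecAt 3 Lc (toSite (ctrOff (3 + 1) Lc)) ((Lc : ℝ) ^ 4) (-((Lc : ℝ) ^ 8 / 2)) cΛ ((Lc : ℝ) ^ 8) cB ((8 * (N : ℝ) ^ 2)⁻¹ • wsym22 N)
        (vh₂SAn1 Lc) (mixFFAt (toSite (ctrOff (3 + 1) Lc)) Lc) k)) Lc (cW * θW ^ k) δW)
    (hδS : 0 < δS) (hδW : 0 < δW) (hθS0 : 0 ≤ θS) (hθS1 : θS < 1) (hθW0 : 0 ≤ θW) (hθW1 : θW < 1) (μ ν : Fin 4) (Nc : ℝ) :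
    D1Drift Lc (JsRowD1 hLc N cΛ cB) Nc μ ν ↔
      B12Beta.secondMoment (hessKer
          (limMKerOf fun j => unitK (sfStep Lc j) (smStep 3 Lc j) (coDressKBmAt (toSite (ctrOff (3 + 1) Lc)) Lc (KInvStep (d := 3) Lc j)))
        (vertexOfK (limMKerOf fun j => unitK (sfStep Lc j) (smStep 3 Lc j) (coDressKBmAt (toSite (ctrOff (3 + 1) Lc)) Lc (KInvStep (d := 3) Lc j))) Lc
          (limStOf fun j => unitS (sfStep Lc j) (smStep 3 Lc j)
            (SrecAt 3 Lc (toSite (ctrOff (3 + 1) Lc)) ((Lc : ℝ) ^ 4) (-((Lc : ℝ) ^ 8 / 2)) cΛ j)))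
        (limTabOf fun j => unitW (sfStep Lc j) (smStep 3 Lc j)
          (WrecAt 3 Lc (toSite (ctrOff (3 + 1) Lc)) ((Lc : ℝ) ^ 4) (-((Lc : ℝ) ^ 8 / 2)) cΛ ((Lc : ℝ) ^ 8) cB ((8 * (N : ℝ) ^ 2)⁻¹ • wsym22 N)
            (vh₂SAn1 Lc) (mixFFAt (toSite (ctrOff (3 + 1) Lc)) Lc) j))) μ ν = B12Normalization.stepBal Nc Lc := by
  rw [JsRowD1_eq_JsRecBmAtOf]
  exact d1Drift_JsRecBmAtOf_iff_of_slots _ _ _ _ _ _ _ _ hLc2 (ctrOff_mem_box hLc.pos) hS hSall hW hWall hδS hδW hθS0 hθS1 hθW0 hθW1 μ ν Nc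

end Record

end

end Summit.QuantumFields.BalabanUV.Beta.HessKerCoDressedBmWallRec
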